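import Literature.Computability.Learning.LearnerQueryFP
import HarnessLib

/-!
# The learner's validation and selection in `FP`

Machine-layer instalment (M8e-2) of the decomposition of the named fact
`Literature.Computability.Learning.cikk_natural_implies_learning` (CIKK 2016, Thm. 5.1): on
`g = ⟨x, answers⟩` (the learner's input and the membership answers in schedule order), the
candidate hypothesis of every run (`candFn`, via `hypFn`), its empirical error on the level's
validation sample (`errsFn`, via the evaluator `evalFn dR`), the test `4a·errs ≤ 3m`
(`passFn`), and the output `lrnGFn dR`: the first passing candidate.

## References

* M. Carmosino, R. Impagliazzo, V. Kabanets, A. Kolokolova, *Learning algorithms from natural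
  proofs*, CCC 2016, §5 (complete algorithm) [CarmosinoImpagliazzoKabanetsKolokolova2016].
-/

open Polynomial

namespace Literature.Computability.Learning

open Literature.Computability.Complexity Literature.Computability.Complexity.Brick
  Literature.Computability.Complexity.Plumb Literature.Computability.MetaComplexity
  Literature.Computability.Cryptography _root_.Computability Finset

section Bricks

variable {dR : List Bool → List Bool} (hdR : dR ∈ FP)

/-- The level argument `⟨x, 1^ℓ⟩` read off `⟨⟨x, answers⟩, 1^ℓ⟩`. [folklore] -/
noncomputable def lvlArgFn : List Bool → List Bool := fanoutFn (fstF ∘ fstF) sndF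

/-- `lvlArgFn ∈ FP`. [folklore] -/
theorem lvlArgFn_mem_FP : lvlArgFn ∈ FP := fanoutFn_mem_FP (comp_mem_FP fstF_mem_FP fstF_mem_FP) sndF_mem_FP

/-- The piece of the query-offset fold on `⟨g, 1^{ℓ'}⟩`, `g = ⟨x, answers⟩`: `⟨nq(ℓ') ↾ (|answers|+1), 1^{|answers|+1}⟩`. [folklore] -/
noncomputable def qoffPiece : List Bool → List Bool :=
  (fanoutFn (takeFn ∘ (fanoutFn (appF ∘ (fanoutFn (onesFn ∘ (sndF ∘ fstF)) (fun _ => [true]))) (nqFn ∘ lvlArgFn))) (appF ∘ (fanoutFn (onesFn ∘ (sndF ∘ fstF)) (fun _ => [true]))))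

/-- `qoffPiece ∈ FP`. [folklore] -/
theorem qoffPiece_mem_FP : qoffPiece ∈ FP :=
  (fanoutFn_mem_FP (comp_mem_FP takeFn_mem_FP (fanoutFn_mem_FP (comp_mem_FP appF_mem_FP (fanoutFn_mem_FP (comp_mem_FP onesFn_mem_FP (comp_mem_FP sndF_mem_FP fstF_mem_FP)) (const_mem_FP _))) (comp_mem_FP nqFn_mem_FP lvlArgFn_mem_FP))) (comp_mem_FP appF_mem_FP (fanoutFn_mem_FP (comp_mem_FP onesFn_mem_FP (comp_mem_FP sndF_mem_FP fstF_mem_FP)) (const_mem_FP _))))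

/-- **The query offset of level `ℓ`** (capped at `|answers|+1`): `Σ_{ℓ'<ℓ} nq(ℓ')`, on `⟨g, 1^ℓ⟩`. [folklore] -/
noncomputable def qoffFn : List Bool → List Bool :=
  (sndPow 2 ∘ (foldLoop coffOp (clipF 4 qoffPiece) X ∘ (fanoutFn fstF (fanoutFn (lenBinF ∘ sndF) (fun _ => boolPair [] [])))))

/-- `qoffFn ∈ FP`. [folklore] -/
theorem qoffFn_mem_FP : qoffFn ∈ FP :=
  (comp_mem_FP (sndPow_mem_FP 2) (comp_mem_FP (foldLoop_clipF_mem_FP (d := 0) 4 coffOp_mem_FP length_coffOp_le qoffPiece_mem_FP X) (fanoutFn_mem_FP fstF_mem_FP (fanoutFn_mem_FP (comp_mem_FP lenBinF_mem_FP sndF_mem_FP) (const_mem_FP _)))))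

/-- The parameter record `prmRec n k ℓ L kk 2^kk t q κ` on `⟨g, 1^ℓ⟩`. [folklore] -/
noncomputable def prmRecFn : List Bool → List Bool :=
  (fanoutFn (nthF 0 ∘ (fstF ∘ (fstF ∘ fstF))) (fanoutFn (kFn ∘ lvlArgFn) (fanoutFn sndF (fanoutFn (bigLFn ∘ lvlArgFn) (fanoutFn (kkFn ∘ lvlArgFn) (fanoutFn (bigKKFn ∘ lvlArgFn) (fanoutFn (tFn ∘ lvlArgFn) (fanoutFn (qFn ∘ lvlArgFn) (kappaFn ∘ lvlArgFn)))))))))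

/-- `prmRecFn ∈ FP`. [folklore] -/
theorem prmRecFn_mem_FP : prmRecFn ∈ FP :=
  (fanoutFn_mem_FP (comp_mem_FP (nthF_mem_FP 0) (comp_mem_FP fstF_mem_FP (comp_mem_FP fstF_mem_FP fstF_mem_FP))) (fanoutFn_mem_FP (comp_mem_FP kFn_mem_FP lvlArgFn_mem_FP) (fanoutFn_mem_FP sndF_mem_FP (fanoutFn_mem_FP (comp_mem_FP bigLFn_mem_FP lvlArgFn_mem_FP) (fanoutFn_mem_FP (comp_mem_FP kkFn_mem_FP lvlArgFn_mem_FP) (fanoutFn_mem_FP (comp_mem_FP bigKKFn_mem_FP lvlArgFn_mem_FP) (fanoutFn_mem_FP (comp_mem_FP tFn_mem_FP lvlArgFn_mem_FP) (fanoutFn_mem_FP (comp_mem_FP qFn_mem_FP lvlArgFn_mem_FP) (comp_mem_FP kappaFn_mem_FP lvlArgFn_mem_FP)))))))))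

/-- **The candidate hypothesis of run `ρ`** of level `ℓ`, on `⟨⟨g, 1^ℓ⟩, 1^ρ⟩`. [cite: CarmosinoImpagliazzoKabanetsKolokolova2016, §5 (complete algorithm)] -/
noncomputable def candFn : List Bool → List Bool :=
  (hypFn ∘ (fanoutFn (prmRecFn ∘ fstF) (fanoutFn (takeFn ∘ (fanoutFn ((runLenFn ∘ lvlArgFn) ∘ fstF) (dropFn ∘ (fanoutFn (appF ∘ (fanoutFn ((coffFn ∘ lvlArgFn) ∘ fstF) (HashBricks.umulFn ∘ (fanoutFn sndF ((runLenFn ∘ lvlArgFn) ∘ fstF))))) ((sndF ∘ (fstF ∘ fstF)) ∘ fstF))))) (takeFn ∘ (fanoutFn ((perRunFn ∘ lvlArgFn) ∘ fstF) (dropFn ∘ (fanoutFn (appF ∘ (fanoutFn (qoffFn ∘ fstF) (HashBricks.umulFn ∘ (fanoutFn sndF ((perRunFn ∘ lvlArgFn) ∘ fstF))))) ((sndF ∘ fstF) ∘ fstF))))))))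

/-- `candFn ∈ FP`. [folklore] -/
theorem candFn_mem_FP : candFn ∈ FP :=
  (comp_mem_FP hypFn_mem_FP (fanoutFn_mem_FP (comp_mem_FP prmRecFn_mem_FP fstF_mem_FP) (fanoutFn_mem_FP (comp_mem_FP takeFn_mem_FP (fanoutFn_mem_FP (comp_mem_FP (comp_mem_FP runLenFn_mem_FP lvlArgFn_mem_FP) fstF_mem_FP) (comp_mem_FP dropFn_mem_FP (fanoutFn_mem_FP (comp_mem_FP appF_mem_FP (fanoutFn_mem_FP (comp_mem_FP (comp_mem_FP coffFn_mem_FP lvlArgFn_mem_FP) fstF_mem_FP) (comp_mem_FP HashBricks.umulFn_mem_FP (fanoutFn_mem_FP sndF_mem_FP (comp_mem_FP (comp_mem_FP runLenFn_mem_FP lvlArgFn_mem_FP) fstF_mem_FP))))) (comp_mem_FP (comp_mem_FP sndF_mem_FP (comp_mem_FP fstF_mem_FP fstF_mem_FP)) fstF_mem_FP))))) (comp_mem_FP takeFn_mem_FP (fanoutFn_mem_FP (comp_mem_FP (comp_mem_FP perRunFn_mem_FP lvlArgFn_mem_FP) fstF_mem_FP) (comp_mem_FP dropFn_mem_FP (fanoutFn_mem_FP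 (comp_mem_FP appF_mem_FP (fanoutFn_mem_FP (comp_mem_FP qoffFn_mem_FP fstF_mem_FP) (comp_mem_FP HashBricks.umulFn_mem_FP (fanoutFn_mem_FP sndF_mem_FP (comp_mem_FP (comp_mem_FP perRunFn_mem_FP lvlArgFn_mem_FP) fstF_mem_FP))))) (comp_mem_FP (comp_mem_FP sndF_mem_FP fstF_mem_FP) fstF_mem_FP))))))))

/-- The piece of the error count on `⟨⟨w, cand⟩, 1^v⟩`: `[E(cand, valpt_v) ≠ label_v]`. [folklore] -/
noncomputable def errPiece (dR : List Bool → List Bool) : List Bool → List Bool :=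
  (HashBricks.xorFn (HashBricks.headBitFn ∘ ((evalFn dR) ∘ (fanoutFn (sndF ∘ fstF) (takeFn ∘ (fanoutFn ((nthF 0 ∘ (fstF ∘ (fstF ∘ fstF))) ∘ (fstF ∘ (fstF ∘ fstF))) (dropFn ∘ (fanoutFn (appF ∘ (fanoutFn ((coffFn ∘ lvlArgFn) ∘ (fstF ∘ (fstF ∘ fstF))) (appF ∘ (fanoutFn (HashBricks.umulFn ∘ (fanoutFn ((repsFn ∘ lvlArgFn) ∘ (fstF ∘ (fstF ∘ fstF))) ((runLenFn ∘ lvlArgFn) ∘ (fstF ∘ (fstF ∘ fstF))))) (HashBricks.umulFn ∘ (fanoutFn sndF ((nthF 0 ∘ (fstF ∘ (fstF ∘ fstF))) ∘ (fstF ∘ (fstF ∘ fstF))))))))) ((sndF ∘ (fstF ∘ fstF)) ∘ (fstF ∘ (fstF ∘ fstF)))))))))) (HashBricks.headBitFn ∘ (bitAtFn ∘ (fanoutFn (appF ∘ (fanoutFn (qoffFn ∘ (fstF ∘ (fstF ∘ fstF))) (appF ∘ (fanoutFn (HashBricks.umulFn ∘ (fanoutFn ((repsFn ∘ lvlArgFn)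 ∘ (fstF ∘ (fstF ∘ fstF))) ((perRunFn ∘ lvlArgFn) ∘ (fstF ∘ (fstF ∘ fstF))))) sndF)))) ((sndF ∘ fstF) ∘ (fstF ∘ (fstF ∘ fstF)))))))

/-- `errPiece dR ∈ FP`. [folklore] -/
theorem errPiece_mem_FP {dR : List Bool → List Bool} (hdR : dR ∈ FP) : errPiece dR ∈ FP := by
  have hE : evalFn dR ∈ FP := evalFn_mem_FP hdR
  exact (HashBricks.xorFn_mem_FP (comp_mem_FP HashBricks.headBitFn_mem_FP (comp_mem_FP hE (fanoutFn_mem_FP (comp_mem_FP sndF_mem_FP fstF_mem_FP) (comp_mem_FP takeFn_mem_FP (fanoutFn_mem_FP (comp_mem_FP (comp_mem_FP (nthF_mem_FP 0) (comp_mem_FP fstF_mem_FP (comp_mem_FP fstF_mem_FP fstF_mem_FP))) (comp_mem_FP fstF_mem_FP (comp_mem_FP fstF_mem_FP fstF_mem_FP))) (comp_mem_FP dropFn_mem_FP (fanoutFn_mem_FP (comp_mem_FP appF_mem_FP (fanoutFn_mem_FP (comp_mem_FP (comp_mem_FP coffFn_mem_FP lvlArgFn_mem_FP) (comp_mem_FP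 fstF_mem_FP (comp_mem_FP fstF_mem_FP fstF_mem_FP))) (comp_mem_FP appF_mem_FP (fanoutFn_mem_FP (comp_mem_FP HashBricks.umulFn_mem_FP (fanoutFn_mem_FP (comp_mem_FP (comp_mem_FP repsFn_mem_FP lvlArgFn_mem_FP) (comp_mem_FP fstF_mem_FP (comp_mem_FP fstF_mem_FP fstF_mem_FP))) (comp_mem_FP (comp_mem_FP runLenFn_mem_FP lvlArgFn_mem_FP) (comp_mem_FP fstF_mem_FP (comp_mem_FP fstF_mem_FP fstF_mem_FP))))) (comp_mem_FP HashBricks.umulFn_mem_FP (fanoutFn_mem_FP sndF_mem_FP (comp_mem_FP (comp_mem_FP (nthF_mem_FP 0) (comp_mem_FP fstF_mem_FP (comp_mem_FP fstF_mem_FP fstF_mem_FP))) (comp_mem_FP fstF_mem_FP (comp_mem_FP fstF_mem_FP fstF_mem_FP))))))))) (comp_mem_FP (comp_mem_FP sndF_mem_FP (comp_mem_FP fstF_mem_FP fstF_mem_FP)) (comp_mem_FP fstF_mem_FP (comp_mem_FP fstF_mem_FP fstF_mem_FP)))))))))) (comp_mem_FP HashBricks.headBitFn_mem_FP (comp_mem_FP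 bitAtFn_mem_FP (fanoutFn_mem_FP (comp_mem_FP appF_mem_FP (fanoutFn_mem_FP (comp_mem_FP qoffFn_mem_FP (comp_mem_FP fstF_mem_FP (comp_mem_FP fstF_mem_FP fstF_mem_FP))) (comp_mem_FP appF_mem_FP (fanoutFn_mem_FP (comp_mem_FP HashBricks.umulFn_mem_FP (fanoutFn_mem_FP (comp_mem_FP (comp_mem_FP repsFn_mem_FP lvlArgFn_mem_FP) (comp_mem_FP fstF_mem_FP (comp_mem_FP fstF_mem_FP fstF_mem_FP))) (comp_mem_FP (comp_mem_FP perRunFn_mem_FP lvlArgFn_mem_FP) (comp_mem_FP fstF_mem_FP (comp_mem_FP fstF_mem_FP fstF_mem_FP))))) sndF_mem_FP)))) (comp_mem_FP (comp_mem_FP sndF_mem_FP fstF_mem_FP) (comp_mem_FP fstF_mem_FP (comp_mem_FP fstF_mem_FP fstF_mem_FP)))))))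

/-- **The empirical error count** `#{v < m | E(cand, valpt_v) ≠ label_v}` (binary), on `⟨w, cand⟩`. [folklore] -/
noncomputable def errsFn (dR : List Bool → List Bool) : List Bool → List Bool :=
  (sndPow 2 ∘ (foldLoop addFn (clipF 1 (errPiece dR)) (2 ^ 20 * (X + 1) ^ 3) ∘ (fanoutFn id (fanoutFn (lenBinF ∘ ((mFn ∘ lvlArgFn) ∘ (fstF ∘ fstF))) (fun _ => boolPair [] [])))))

/-- `errsFn dR ∈ FP`. [folklore] -/
theorem errsFn_mem_FP {dR : List Bool → List Bool} (hdR : dR ∈ FP) : errsFn dR ∈ FP :=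
  (comp_mem_FP (sndPow_mem_FP 2) (comp_mem_FP (foldLoop_clipF_mem_FP 1 addFn_mem_FP length_addFn_le (errPiece_mem_FP hdR) (2 ^ 20 * (X + 1) ^ 3)) (fanoutFn_mem_FP (PolyTimeComputable.id _) (fanoutFn_mem_FP (comp_mem_FP lenBinF_mem_FP (comp_mem_FP (comp_mem_FP mFn_mem_FP lvlArgFn_mem_FP) (comp_mem_FP fstF_mem_FP fstF_mem_FP))) (const_mem_FP _)))))

/-- **The validation test** `[4a·errs ≤ 3m]` on `⟨w, cand⟩`. [folklore] -/
noncomputable def passFn (dR : List Bool → List Bool) : List Bool → List Bool :=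
  (notFn (ltLenF ∘ (fanoutFn (HashBricks.umulFn ∘ (fanoutFn (fun _ => ones 3) ((mFn ∘ lvlArgFn) ∘ (fstF ∘ fstF)))) (HashBricks.umulFn ∘ (fanoutFn (HashBricks.umulFn ∘ (fanoutFn (fun _ => ones 4) ((nthF 1 ∘ (fstF ∘ (fstF ∘ fstF))) ∘ (fstF ∘ fstF)))) (binToUnaryFn ∘ (fanoutFn ((mFn ∘ lvlArgFn) ∘ (fstF ∘ fstF)) (errsFn dR))))))))

/-- `passFn dR ∈ FP`. [folklore] -/
theorem passFn_mem_FP {dR : List Bool → List Bool} (hdR : dR ∈ FP) : passFn dR ∈ FP :=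
  (notFn_mem_FP (comp_mem_FP ltLenF_mem_FP (fanoutFn_mem_FP (comp_mem_FP HashBricks.umulFn_mem_FP (fanoutFn_mem_FP (const_mem_FP _) (comp_mem_FP (comp_mem_FP mFn_mem_FP lvlArgFn_mem_FP) (comp_mem_FP fstF_mem_FP fstF_mem_FP)))) (comp_mem_FP HashBricks.umulFn_mem_FP (fanoutFn_mem_FP (comp_mem_FP HashBricks.umulFn_mem_FP (fanoutFn_mem_FP (const_mem_FP _) (comp_mem_FP (comp_mem_FP (nthF_mem_FP 1) (comp_mem_FP fstF_mem_FP (comp_mem_FP fstF_mem_FP fstF_mem_FP))) (comp_mem_FP fstF_mem_FP fstF_mem_FP)))) (comp_mem_FP binToUnaryFn_mem_FP (fanoutFn_mem_FP (comp_mem_FP (comp_mem_FP mFn_mem_FP lvlArgFn_mem_FP) (comp_mem_FP fstF_mem_FP fstF_mem_FP)) (errsFn_mem_FP hdR))))))))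

/-- The piece of the level selection on `⟨⟨g, 1^ℓ⟩, 1^ρ⟩`: the candidate of run `ρ` if it passes
validation, `ε` otherwise. [folklore] -/
noncomputable def selPiece (dR : List Bool → List Bool) : List Bool → List Bool :=
  (iteFn (passFn dR ∘ fanoutFn id candFn) candFn (fun _ => []))

/-- `selPiece dR ∈ FP`. [folklore] -/
theorem selPiece_mem_FP {dR : List Bool → List Bool} (hdR : dR ∈ FP) : selPiece dR ∈ FP :=
  (iteFn_mem_FP (comp_mem_FP (passFn_mem_FP hdR) (fanoutFn_mem_FP (PolyTimeComputable.id _) candFn_mem_FP)) candFn_mem_FP (const_mem_FP _))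

/-- The op "keep the first nonempty": `⟨acc, piece⟩ ↦ acc` if `acc ≠ ε`, else `piece`. [folklore] -/
noncomputable def firstOp : List Bool → List Bool := iteFn (isNilFn ∘ fstF) sndF fstF

/-- `firstOp ∈ FP`. [folklore] -/
theorem firstOp_mem_FP : firstOp ∈ FP := iteFn_mem_FP (comp_mem_FP isNilFn_mem_FP fstF_mem_FP) sndF_mem_FP fstF_mem_FP

/-- `firstOp` has additive growth. [folklore] -/
theorem length_firstOp_le (w : List Bool) : (firstOp w).length ≤ (fstF w).length + (sndF w).length + 0 := by
  rw [firstOp, iteFn_of_oneBit (oneBit_isNilFn.comp _)]; split_ifs <;> omega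

/-- Value of `firstOp`. [folklore] -/
theorem firstOp_boolPair (acc piece : List Bool) : firstOp (boolPair acc piece) = if acc = [] then piece else acc := by
  rw [firstOp, iteFn_apply (b := decide (acc = [])) (by simp [isNilFn])]
  by_cases h : acc = [] <;> simp [h]

/-- **The selection of level `ℓ`**: the first passing candidate among the `Reps` runs (`ε` if none), on `⟨g, 1^ℓ⟩`.
[cite: CarmosinoImpagliazzoKabanetsKolokolova2016, §5 (complete algorithm)] -/
noncomputable def levelSelFn (dR : List Bool → List Bool) : List Bool → List Bool :=
  (sndPow 2 ∘ (foldLoop firstOp (clipF 512 (selPiece dR)) X ∘ (fanoutFn id (fanoutFn (lenBinF ∘ (iteFn (processedFn ∘ lvlArgFn) (repsFn ∘ lvlArgFn) (fun _ => []))) (fun _ => boolPair [] [])))))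

/-- `levelSelFn dR ∈ FP`. [folklore] -/
theorem levelSelFn_mem_FP {dR : List Bool → List Bool} (hdR : dR ∈ FP) : levelSelFn dR ∈ FP :=
  (comp_mem_FP (sndPow_mem_FP 2) (comp_mem_FP (foldLoop_clipF_mem_FP (d := 0) 512 firstOp_mem_FP length_firstOp_le (selPiece_mem_FP hdR) X) (fanoutFn_mem_FP (PolyTimeComputable.id _) (fanoutFn_mem_FP (comp_mem_FP lenBinF_mem_FP (iteFn_mem_FP (comp_mem_FP processedFn_mem_FP lvlArgFn_mem_FP) (comp_mem_FP repsFn_mem_FP lvlArgFn_mem_FP) (const_mem_FP _))) (const_mem_FP _)))))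

/-- **The learner's output function `G`**: the first passing candidate over the levels `ℓ ≤ |r|` in
order (and the runs in order), on `g = ⟨x, answers⟩`. [cite: CarmosinoImpagliazzoKabanetsKolokolova2016, §5 (complete algorithm)] -/
noncomputable def lrnGFn (dR : List Bool → List Bool) : List Bool → List Bool :=
  (sndPow 2 ∘ (foldLoop firstOp (clipF 512 (levelSelFn dR)) X ∘ (fanoutFn id (fanoutFn (lenBinF ∘ (appF ∘ (fanoutFn (onesFn ∘ (sndF ∘ fstF)) (fun _ => [true])))) (fun _ => boolPair [] [])))))

/-- `lrnGFn dR ∈ FP`. [folklore] -/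
theorem lrnGFn_mem_FP {dR : List Bool → List Bool} (hdR : dR ∈ FP) : lrnGFn dR ∈ FP :=
  (comp_mem_FP (sndPow_mem_FP 2) (comp_mem_FP (foldLoop_clipF_mem_FP (d := 0) 512 firstOp_mem_FP length_firstOp_le (levelSelFn_mem_FP hdR) X) (fanoutFn_mem_FP (PolyTimeComputable.id _) (fanoutFn_mem_FP (comp_mem_FP lenBinF_mem_FP (comp_mem_FP appF_mem_FP (fanoutFn_mem_FP (comp_mem_FP onesFn_mem_FP (comp_mem_FP sndF_mem_FP fstF_mem_FP)) (const_mem_FP _)))) (const_mem_FP _)))))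


end Bricks

/-! ### The schedule of a level: offsets and the answers of a run -/

section ScheduleFacts

variable {n a b : ℕ} {r : List Bool}

/-- The query offset of level `ℓ`: `Σ_{ℓ'<ℓ} lvlNQ ℓ'`. [folklore] -/
noncomputable def lvlQoff (n a b : ℕ) (r : List Bool) (ℓ : ℕ) : ℕ := ∑ ℓ' ∈ Finset.range ℓ, lvlNQ n a b r ℓ'

/-- The search state before level `L ≤ ℓ` on the index `lvlQoff ℓ + u`. [folklore] -/
theorem qState_before {ℓ u : ℕ} : ∀ L, L ≤ ℓ →
    qState n a b r (lvlQoff n a b r ℓ + u) L = (lvlQoff n a b r ℓ + u - lvlQoff n a b r L, none)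
  | 0, _ => by simp [qState, lvlQoff]
  | L + 1, hL => by
    rw [qState, qState_before L (by omega)]
    dsimp only
    have hge : lvlNQ n a b r L ≤ lvlQoff n a b r ℓ + u - lvlQoff n a b r L := by
      have : lvlQoff n a b r (L + 1) ≤ lvlQoff n a b r ℓ :=
        Finset.sum_le_sum_of_subset (Finset.range_mono (by omega))
      rw [lvlQoff, Finset.sum_range_succ, ← lvlQoff] at this
      omega
    rw [if_neg (not_lt.2 hge)]
    have hs : lvlQoff n a b r (L + 1) = lvlQoff n a b r L + lvlNQ n a b r L := by
      rw [lvlQoff, Finset.sum_range_succ, ← lvlQoff]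
    rw [hs]
    exact Prod.ext (by dsimp only; omega) rfl

/-- **The scheduled query at `lvlQoff ℓ + u` is `lvlQuery ℓ u`** (`ℓ ≤ |r|`, `u < lvlNQ ℓ`). [folklore] -/
theorem schedQuery_lvl {ℓ u : ℕ} (hℓ : ℓ ≤ r.length) (hu : u < lvlNQ n a b r ℓ) :
    schedQuery n a b r (lvlQoff n a b r ℓ + u) = lvlQuery n a b r ℓ u := by
  have hat : qState n a b r (lvlQoff n a b r ℓ + u) (ℓ + 1) = (u, some (lvlQuery n a b r ℓ u)) := by
    rw [qState, qState_before ℓ le_rfl]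
    dsimp only
    rw [Nat.add_sub_cancel_left, if_pos hu]
  have hstay : ∀ d, qState n a b r (lvlQoff n a b r ℓ + u) (ℓ + 1 + d) = (u, some (lvlQuery n a b r ℓ u)) := by
    intro d
    induction d with
    | zero => exact hat
    | succ d ih => rw [show ℓ + 1 + (d + 1) = (ℓ + 1 + d) + 1 by omega, qState, ih]
  rw [schedQuery, show r.length + 1 = ℓ + 1 + (r.length - ℓ) by omega, hstay]
  simp

/-- Index arithmetic of the table queries. [folklore] -/
theorem tableIdx_arith {L K j c blk : ℕ} (hK : 0 < K) (hc : c < L) (hblk : blk < K) :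
    ((j * L + c) * K + blk) / (L * K) = j ∧ ((j * L + c) * K + blk) / K % L = c ∧ ((j * L + c) * K + blk) % K = blk := by
  have hL : 0 < L := by omega
  have h1 : ((j * L + c) * K + blk) / K = j * L + c := by
    rw [Nat.add_comm, Nat.add_mul_div_right _ _ hK, Nat.div_eq_of_lt hblk, Nat.zero_add]
  refine ⟨?_, ?_, ?_⟩
  · rw [mul_comm L K, ← Nat.div_div_eq_div_mul, h1, Nat.add_comm, Nat.add_mul_div_right _ _ hL, Nat.div_eq_of_lt hc,
      Nat.zero_add]
  · rw [h1, Nat.add_comm, Nat.add_mul_mod_self_right, Nat.mod_eq_of_lt hc]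
  · rw [Nat.add_comm, Nat.add_mul_mod_self_right, Nat.mod_eq_of_lt hblk]

/-- The total number of scheduled queries (levels `ℓ ≤ |r|`). [folklore] -/
noncomputable def totalNQ (n a b : ℕ) (r : List Bool) : ℕ := lvlQoff n a b r (r.length + 1)

/-- **The answers are the true ones**: `ans[idx] = f(y_{idx})` for all `idx < |ans|`, and all scheduled
queries are answered. [folklore] -/
def TrueAnswers (n a b : ℕ) (r : List Bool) (f : (Fin n → Bool) → Bool) (ans : List Bool) : Prop :=
  totalNQ n a b r ≤ ans.length ∧ ∀ idx < ans.length, ans.getD idx false = f (schedQuery n a b r idx)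

variable {f : (Fin n → Bool) → Bool} {ans : List Bool} {ℓ : ℕ}

/-- The answer segment of run `ρ` of level `ℓ`. [folklore] -/
noncomputable def ansSeg (n a b : ℕ) (r : List Bool) (ans : List Bool) (ℓ ρ : ℕ) : List Bool :=
  slice ans (lvlQoff n a b r ℓ + ρ * lvlPerRun n a b ℓ) (lvlPerRun n a b ℓ)

/-- The queries of level `ℓ ≤ |r|` are within the total. [folklore] -/
theorem lvlQoff_add_le (hℓ : ℓ ≤ r.length) : lvlQoff n a b r ℓ + lvlNQ n a b r ℓ ≤ totalNQ n a b r := by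
  rw [totalNQ, lvlQoff, lvlQoff, ← Finset.sum_range_succ]
  exact Finset.sum_le_sum_of_subset (Finset.range_mono (by omega))

/-- `lvlNQ` on a processed level. [folklore] -/
theorem lvlNQ_of_processed (h : LvlProcessed n a b r.length ℓ) :
    lvlNQ n a b r ℓ = prmReps (prmS n a b) ℓ * lvlPerRun n a b ℓ + prmM (prmS n a b) ℓ := by rw [lvlNQ, if_pos h]

/-- Reading the answers of a run: local index `u < Reps·perRun` of a processed level. [folklore] -/
theorem ans_getD_run (hT : TrueAnswers n a b r f ans) (h : LvlProcessed n a b r.length ℓ) (hℓ : ℓ ≤ r.length) {u : ℕ}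
    (hu : u < prmReps (prmS n a b) ℓ * lvlPerRun n a b ℓ + prmM (prmS n a b) ℓ) :
    ans.getD (lvlQoff n a b r ℓ + u) false = f (lvlQuery n a b r ℓ u) := by
  have hu' : u < lvlNQ n a b r ℓ := by rwa [lvlNQ_of_processed h]
  rw [hT.2 _ (lt_of_lt_of_le (by have := lvlQoff_add_le (n := n) (a := a) (b := b) hℓ; omega) hT.1), schedQuery_lvl hℓ hu']

/-- **The answer segment of a run is correct for the table queries.** [folklore] -/
theorem answersOK_ansSeg (hT : TrueAnswers n a b r f ans) (h : LvlProcessed n a b r.length ℓ) (hℓ : ℓ ≤ r.length) {ρ : ℕ}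
    (hρ : ρ < prmReps (prmS n a b) ℓ) :
    AnswersOK (lvl_hn n a b ℓ) f (lvlCoins n a b r ℓ ρ).1.1 (lvlCoins n a b r ℓ ρ).1.2.1 (ansSeg n a b r ans ℓ ρ) := by
  intro j c hj hc
  have hK := lvlK_pos n a b ℓ
  have hper : lvlPerRun n a b ℓ = 2 ^ ℓ * 2 ^ ℓ * lvlK n a b ℓ + lvlK n a b ℓ := rfl
  have hfit : lvlQoff n a b r ℓ + ρ * lvlPerRun n a b ℓ + lvlPerRun n a b ℓ ≤ ans.length := by
    have h1 : (ρ + 1) * lvlPerRun n a b ℓ ≤ prmReps (prmS n a b) ℓ * lvlPerRun n a b ℓ := Nat.mul_le_mul_right _ hρ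
    have h2 := lvlQoff_add_le (n := n) (a := a) (b := b) (r := r) hℓ
    rw [lvlNQ_of_processed h] at h2
    rw [Nat.succ_mul] at h1
    have := hT.1; omega
  have hjc : (j * 2 ^ ℓ + c) * lvlK n a b ℓ + lvlK n a b ℓ ≤ 2 ^ ℓ * 2 ^ ℓ * lvlK n a b ℓ := by
    have : (j * 2 ^ ℓ + c + 1) * lvlK n a b ℓ ≤ 2 ^ ℓ * 2 ^ ℓ * lvlK n a b ℓ :=
      Nat.mul_le_mul_right _ (by nlinarith)
    rw [Nat.succ_mul] at this; exact this
  apply List.ext_getElem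
  · rw [List.length_take, List.length_drop, ansSeg, length_slice hfit, List.length_ofFn, hper]
    generalize (j * 2 ^ ℓ + c) * lvlK n a b ℓ = Z at hjc ⊢
    generalize 2 ^ ℓ * 2 ^ ℓ * lvlK n a b ℓ = W at hjc ⊢
    omega
  · intro blk h1 h2
    rw [List.length_ofFn] at h2
    have htab : (j * 2 ^ ℓ + c) * lvlK n a b ℓ + blk < 2 ^ ℓ * 2 ^ ℓ * lvlK n a b ℓ := by
      have hjc' := hjc
      generalize (j * 2 ^ ℓ + c) * lvlK n a b ℓ = Z at hjc' ⊢
      generalize 2 ^ ℓ * 2 ^ ℓ * lvlK n a b ℓ = W at hjc' ⊢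
      omega
    have hlt : (j * 2 ^ ℓ + c) * lvlK n a b ℓ + blk < lvlPerRun n a b ℓ := by rw [hper]; omega
    have hrun : ρ * lvlPerRun n a b ℓ + ((j * 2 ^ ℓ + c) * lvlK n a b ℓ + blk) < prmReps (prmS n a b) ℓ * lvlPerRun n a b ℓ := by
      have h3 : (ρ + 1) * lvlPerRun n a b ℓ ≤ prmReps (prmS n a b) ℓ * lvlPerRun n a b ℓ := Nat.mul_le_mul_right _ hρ
      rw [Nat.succ_mul] at h3; omega
    rw [List.getElem_take, List.getElem_drop, List.getElem_ofFn, ← List.getD_eq_getElem _ false, ansSeg,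
      getD_slice (by omega), Nat.add_assoc, ans_getD_run hT h hℓ (by omega)]
    -- unfold the schedule at this index
    have hdiv : (ρ * lvlPerRun n a b ℓ + ((j * 2 ^ ℓ + c) * lvlK n a b ℓ + blk)) / lvlPerRun n a b ℓ = ρ := by
      rw [Nat.add_comm, Nat.add_mul_div_right _ _ (by omega), Nat.div_eq_of_lt hlt, Nat.zero_add]
    have hmod : (ρ * lvlPerRun n a b ℓ + ((j * 2 ^ ℓ + c) * lvlK n a b ℓ + blk)) % lvlPerRun n a b ℓ =
        (j * 2 ^ ℓ + c) * lvlK n a b ℓ + blk := by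
      rw [Nat.add_comm, Nat.add_mul_mod_self_right, Nat.mod_eq_of_lt hlt]
    obtain ⟨a1, a2, a3⟩ := tableIdx_arith (j := j) hK hc h2
    rw [lvlQuery, if_pos hrun]
    dsimp only
    rw [hdiv]
    simp only [hmod, dif_pos htab, a1, a2, a3]

/-- **The answer segment of a run is correct for the trusted tuple.** [folklore] -/
theorem ansSeg_trusted (hT : TrueAnswers n a b r f ans) (h : LvlProcessed n a b r.length ℓ) (hℓ : ℓ ≤ r.length) {ρ : ℕ}
    (hρ : ρ < prmReps (prmS n a b) ℓ) :
    ((ansSeg n a b r ans ℓ ρ).drop (2 ^ ℓ * 2 ^ ℓ * lvlK n a b ℓ)).take (lvlK n a b ℓ) =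
      List.ofFn (f ∘ (lvlCoins n a b r ℓ ρ).2.2.2.1) := by
  have hK := lvlK_pos n a b ℓ
  have hper : lvlPerRun n a b ℓ = 2 ^ ℓ * 2 ^ ℓ * lvlK n a b ℓ + lvlK n a b ℓ := rfl
  have hfit : lvlQoff n a b r ℓ + ρ * lvlPerRun n a b ℓ + lvlPerRun n a b ℓ ≤ ans.length := by
    have h1 : (ρ + 1) * lvlPerRun n a b ℓ ≤ prmReps (prmS n a b) ℓ * lvlPerRun n a b ℓ := Nat.mul_le_mul_right _ hρ
    have h2 := lvlQoff_add_le (n := n) (a := a) (b := b) (r := r) hℓ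
    rw [lvlNQ_of_processed h] at h2
    rw [Nat.succ_mul] at h1
    have := hT.1; omega
  apply List.ext_getElem
  · rw [List.length_take, List.length_drop, ansSeg, length_slice hfit, List.length_ofFn, hper]; omega
  · intro blk h1 h2
    rw [List.length_ofFn] at h2
    have hlt : 2 ^ ℓ * 2 ^ ℓ * lvlK n a b ℓ + blk < lvlPerRun n a b ℓ := by rw [hper]; omega
    have hrun : ρ * lvlPerRun n a b ℓ + (2 ^ ℓ * 2 ^ ℓ * lvlK n a b ℓ + blk) < prmReps (prmS n a b) ℓ * lvlPerRun n a b ℓ := by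
      have h3 : (ρ + 1) * lvlPerRun n a b ℓ ≤ prmReps (prmS n a b) ℓ * lvlPerRun n a b ℓ := Nat.mul_le_mul_right _ hρ
      rw [Nat.succ_mul] at h3; omega
    have hdiv : (ρ * lvlPerRun n a b ℓ + (2 ^ ℓ * 2 ^ ℓ * lvlK n a b ℓ + blk)) / lvlPerRun n a b ℓ = ρ := by
      rw [Nat.add_comm, Nat.add_mul_div_right _ _ (by omega), Nat.div_eq_of_lt hlt, Nat.zero_add]
    have hmod : (ρ * lvlPerRun n a b ℓ + (2 ^ ℓ * 2 ^ ℓ * lvlK n a b ℓ + blk)) % lvlPerRun n a b ℓ =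
        2 ^ ℓ * 2 ^ ℓ * lvlK n a b ℓ + blk := by
      rw [Nat.add_comm, Nat.add_mul_mod_self_right, Nat.mod_eq_of_lt hlt]
    rw [List.getElem_take, List.getElem_drop, List.getElem_ofFn, ← List.getD_eq_getElem _ false, ansSeg,
      getD_slice (by omega), Nat.add_assoc, ans_getD_run hT h hℓ (by omega), lvlQuery, if_pos hrun]
    dsimp only
    rw [hdiv]
    have hnot : ¬ (2 ^ ℓ * 2 ^ ℓ * lvlK n a b ℓ + blk < 2 ^ ℓ * 2 ^ ℓ * lvlK n a b ℓ) := by omega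
    simp only [hmod, dif_neg hnot, Function.comp_apply, Nat.add_sub_cancel_left, Nat.mod_eq_of_lt h2]

/-- **The labels of the validation points are the true values.** [folklore] -/
theorem ans_getD_label (hT : TrueAnswers n a b r f ans) (h : LvlProcessed n a b r.length ℓ) (hℓ : ℓ ≤ r.length) {w : ℕ}
    (hw : w < prmM (prmS n a b) ℓ) :
    ans.getD (lvlQoff n a b r ℓ + (prmReps (prmS n a b) ℓ * lvlPerRun n a b ℓ + w)) false = f (lvlValPt n a b r ℓ w) := by
  rw [ans_getD_run hT h hℓ (by omega), lvlQuery, if_neg (by omega), Nat.add_sub_cancel_left]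

end ScheduleFacts

/-! ### Values of the selection bricks -/

section Values

variable {n a b : ℕ} {r : List Bool} {f : (Fin n → Bool) → Bool} {ans : List Bool}
  {dR : List Bool → List Bool} (R : CombinatorialProperty)

/-- The learner's input with answers: `g = ⟨⟨pacParams n a b, r⟩, ans⟩`. [folklore] -/
def gArg (n a b : ℕ) (r ans : List Bool) : List Bool := boolPair (boolPair (pacParams n a b) r) ans

/-- The level context `⟨g, 1^ℓ⟩`. [folklore] -/
def vArg (n a b : ℕ) (r ans : List Bool) (ℓ : ℕ) : List Bool := boolPair (gArg n a b r ans) (ones ℓ)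

/-- The run context `⟨⟨g, 1^ℓ⟩, 1^ρ⟩`. [folklore] -/
def wArg (n a b : ℕ) (r ans : List Bool) (ℓ ρ : ℕ) : List Bool := boolPair (vArg n a b r ans ℓ) (ones ρ)

omit R in
/-- Accessors on the level context. [folklore] -/
theorem vArg_fields (ℓ : ℕ) :
    lvlArgFn (vArg n a b r ans ℓ) = lrnArg n a b r ℓ ∧ sndF (fstF (vArg n a b r ans ℓ)) = ans ∧
      sndF (fstF (fstF (vArg n a b r ans ℓ))) = r ∧ nthF 0 (fstF (fstF (fstF (vArg n a b r ans ℓ)))) = ones n ∧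
      nthF 1 (fstF (fstF (fstF (vArg n a b r ans ℓ)))) = ones a ∧ sndF (vArg n a b r ans ℓ) = ones ℓ := by
  simp [lvlArgFn, vArg, gArg, lrnArg, pacParams, nthF, unaryEncodeNat_eq_ones]

/-! #### The query offset -/

omit R in
/-- A capped-sum fold, pieces known below a bound (general form of `foldAcc_coffOp`). [folklore] -/
theorem foldAcc_coffOp' {piece : List Bool → List Bool} (x : List Bool) (F : ℕ → ℕ) (Cc J : ℕ)
    (hx : ∀ j, j < J → piece (boolPair x (ones j)) = boolPair (ones (min (F j) Cc)) (ones Cc)) :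
    ∀ j : ℕ, j ≤ J → foldAcc coffOp piece x 0 j [] = ones (min (∑ ℓ' ∈ Finset.range j, F ℓ') Cc)
  | 0, _ => by simp [ones]
  | j + 1, hj => by
    rw [foldAcc_succ', foldAcc_coffOp' x F Cc J hx j (by omega), zero_add, hx j (by omega), coffOp_apply, ones_append_ones,
      length_ones, take_ones, Nat.min_comm, min_add_min_min, Finset.sum_range_succ]

omit R in
/-- Value of `qoffPiece` (`j ≤ |r|`). [folklore] -/
theorem qoffPiece_apply (hR : 1 ≤ r.length) {j : ℕ} (hj : j ≤ r.length) :
    qoffPiece (boolPair (gArg n a b r ans) (ones j)) = boolPair (ones (min (lvlNQ n a b r j) (ans.length + 1))) (ones (ans.length + 1)) := by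
  have hcap : onesFn ans ++ [true] = ones (ans.length + 1) := by
    rw [onesFn_eq_ones, show [true] = ones 1 from rfl, ones_append_ones]
  have hz : lvlArgFn (boolPair (gArg n a b r ans) (ones j)) = lrnArg n a b r j := by
    rw [lvlArgFn, fanoutFn_apply, gArg, lrnArg]; simp
  have hsnd : sndF (gArg n a b r ans) = ans := by simp [gArg]
  rw [qoffPiece, fanoutFn_apply]
  simp only [Function.comp_apply, fanoutFn_apply, fstF_boolPair, appF_boolPair, hsnd, hcap, takeFn_boolPair,
    length_ones, hz, nqFn_apply n a b r hR hj, take_ones, Nat.min_comm]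

omit R in
/-- **Value of `qoffFn`** (`ℓ ≤ |r|+1`, true answers): `1^{lvlQoff ℓ}`. [folklore] -/
theorem qoffFn_apply (hR : 1 ≤ r.length) (hT : TrueAnswers n a b r f ans) {ℓ : ℕ} (hℓ : ℓ ≤ r.length + 1) :
    qoffFn (vArg n a b r ans ℓ) = ones (lvlQoff n a b r ℓ) := by
  have hrounds : ℓ ≤ X.eval (fstF (vArg n a b r ans ℓ)).length := by
    rw [eval_X, vArg, fstF_boolPair, gArg, length_boolPair, length_boolPair]; omega
  have hx : ∀ j, j < ℓ → qoffPiece (boolPair (gArg n a b r ans) (ones j)) =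
      boolPair (ones (min (lvlNQ n a b r j) (ans.length + 1))) (ones (ans.length + 1)) :=
    fun j hj => qoffPiece_apply hR (by omega)
  have h1 : lvlQoff n a b r ℓ ≤ totalNQ n a b r := Finset.sum_le_sum_of_subset (Finset.range_mono hℓ)
  have h2 := hT.1
  rw [qoffFn, Function.comp_apply, Function.comp_apply, fanoutFn_apply, fanoutFn_apply, Function.comp_apply,
    show sndF (vArg n a b r ans ℓ) = ones ℓ by simp [vArg], lenBinF_apply, length_ones,
    show (boolPair ([] : List Bool) []) = boolPair (ones 0) ([] : List Bool) by rfl, foldLoop_apply _ _ hrounds,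
    show fstF (vArg n a b r ans ℓ) = gArg n a b r ans by simp [vArg],
    foldAcc_clipF (fun j _ hj => by
      rw [zero_add] at hj
      rw [hx j hj, length_boolPair, length_ones, length_ones, gArg, length_boolPair]
      have := min_le_right (lvlNQ n a b r j) (ans.length + 1)
      omega),
    foldAcc_coffOp' (gArg n a b r ans) (lvlNQ n a b r) (ans.length + 1) ℓ hx ℓ le_rfl]
  simp only [sndPow, Function.comp_apply, sndF_boolPair]
  rw [← lvlQoff, min_eq_left (by omega)]

/-! #### The candidate of a run -/

/-- **The candidate hypothesis string of run `ρ` of level `ℓ`**: the run's `hypRec` with the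
learner's tables. [cite: CarmosinoImpagliazzoKabanetsKolokolova2016, §5] -/
noncomputable def candStr (n a b : ℕ) (r : List Bool) (f : (Fin n → Bool) → Bool) (ℓ ρ : ℕ) : List Bool :=
  hypRec [] (lvlQ n a b ℓ) n (lvlK n a b ℓ) ℓ (prmKK (prmS n a b) ℓ) (prmT (prmS n a b) ℓ)
    (List.ofFn fun j : Fin (2 ^ ℓ) => learnerTable (lvl_hn n a b ℓ) f (lvlCoins n a b r ℓ ρ).1.1 j (lvlCoins n a b r ℓ ρ).1.2.1)
    f (lvlCoins n a b r ℓ ρ)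

omit R in
/-- Value of `prmRecFn` on a processed level. [folklore] -/
theorem prmRecFn_apply {ℓ : ℕ} (h : LvlProcessed n a b r.length ℓ) :
    prmRecFn (vArg n a b r ans ℓ) = prmRec n (lvlK n a b ℓ) ℓ (2 ^ ℓ) (prmKK (prmS n a b) ℓ) (2 ^ prmKK (prmS n a b) ℓ)
      (prmT (prmS n a b) ℓ) (lvlQ n a b ℓ) (prmKappa (prmS n a b) ℓ) := by
  obtain ⟨hk, hL, hT, hReps, hq, hrl, hcoff, hper, hKK⟩ := bricks_of_processed h
  obtain ⟨v1, v2, v3, v4, v5, v6⟩ := vArg_fields (n := n) (a := a) (b := b) (r := r) (ans := ans) ℓ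
  rw [prmRecFn]
  simp only [fanoutFn_apply, Function.comp_apply, v1, v4, v6, hk, hL, hT, hq, hKK, kkFn_apply, kappaFn_apply, prmRec]

omit R in
/-- **Value of `candFn`**: the candidate string `candStr` (processed level `ℓ ≤ |r|`, `ρ < Reps`, true answers).
[cite: CarmosinoImpagliazzoKabanetsKolokolova2016, §5] -/
theorem candFn_apply (hR : 1 ≤ r.length) (hT : TrueAnswers n a b r f ans) {ℓ : ℕ} (h : LvlProcessed n a b r.length ℓ)
    (hℓ : ℓ ≤ r.length) {ρ : ℕ} (hρ : ρ < prmReps (prmS n a b) ℓ) :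
    candFn (wArg n a b r ans ℓ ρ) = candStr n a b r f ℓ ρ := by
  obtain ⟨hk, hL, hT', hReps, hq, hrl, hcoff, hper, hKK⟩ := bricks_of_processed h
  obtain ⟨v1, v2, v3, v4, v5, v6⟩ := vArg_fields (n := n) (a := a) (b := b) (r := r) (ans := ans) ℓ
  rw [candFn, Function.comp_apply, fanoutFn_apply, fanoutFn_apply, wArg]
  simp only [Function.comp_apply, fanoutFn_apply, fstF_boolPair, sndF_boolPair, v1, v2, v3, hrl, hcoff, hper,
    qoffFn_apply hR hT (hℓ.trans (Nat.le_succ _)), prmRecFn_apply h, HashBricks.umulFn_boolPair, appF_boolPair,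
    ones_append_ones, takeFn_boolPair, dropFn_boolPair, length_ones]
  rw [candStr, show List.take (lvlRunLen n a b ℓ) (List.drop (lvlCoff n a b ℓ + ρ * lvlRunLen n a b ℓ) r) = lvlSeg n a b r ℓ ρ from rfl,
    show List.take (lvlPerRun n a b ℓ) (List.drop (lvlQoff n a b r ℓ + ρ * lvlPerRun n a b ℓ) ans) = ansSeg n a b r ans ℓ ρ from rfl,
    lvlCoins]
  have hLk : 2 ^ ℓ ≤ (ansSeg n a b r ans ℓ ρ).length := by
    rw [ansSeg, length_slice]
    · rw [lvlPerRun]; have := lvlK_pos n a b ℓ; nlinarith [Nat.one_le_two_pow (n := ℓ)]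
    · have h1 : (ρ + 1) * lvlPerRun n a b ℓ ≤ prmReps (prmS n a b) ℓ * lvlPerRun n a b ℓ := Nat.mul_le_mul_right _ hρ
      have h2 := lvlQoff_add_le (n := n) (a := a) (b := b) (r := r) hℓ
      rw [lvlNQ_of_processed h] at h2
      rw [Nat.succ_mul] at h1
      have := hT.1; omega
  exact hypFn_apply (lvl_hn n a b ℓ) (two_pow_kappa_le_lvlK n a b ℓ) (lvlK_pos n a b ℓ) f (lvlSeg n a b r ℓ ρ)
    (length_lvlSeg h hρ) (ansSeg n a b r ans ℓ ρ) (answersOK_ansSeg hT h hℓ hρ) (ansSeg_trusted hT h hℓ hρ) hLk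

/-! #### Length of the candidate string -/

omit R in
/-- `|body l| = Σ (2|x| + 2)`. [folklore] -/
theorem length_body (l : List (List Bool)) : (OracleCompose.body l).length = (l.map fun x => 2 * x.length + 2).sum := by
  induction l with
  | nil => rfl
  | cons x l ih => rw [OracleCompose.body_cons, length_boolPair, ih, List.map_cons, List.sum_cons, Nat.add_comm]

omit R in
/-- The tables code is at most `L(2L+2)` long. [folklore] -/
theorem length_tables_le {ℓ ρ : ℕ} :
    (OracleCompose.body (List.ofFn fun j : Fin (2 ^ ℓ) =>
      learnerTable (lvl_hn n a b ℓ) f (lvlCoins n a b r ℓ ρ).1.1 j (lvlCoins n a b r ℓ ρ).1.2.1)).length ≤ 2 ^ ℓ * (2 * 2 ^ ℓ + 2) := by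
  rw [length_body, List.map_ofFn, List.sum_ofFn]
  have hE : ∀ j : Fin (2 ^ ℓ), (learnerTable (lvl_hn n a b ℓ) f (lvlCoins n a b r ℓ ρ).1.1 j (lvlCoins n a b r ℓ ρ).1.2.1).length ≤ 2 ^ ℓ :=
    fun j => by rw [learnerTable, List.length_ofFn]; exact min_le_right _ _
  calc ∑ j : Fin (2 ^ ℓ), (2 * (learnerTable (lvl_hn n a b ℓ) f (lvlCoins n a b r ℓ ρ).1.1 j (lvlCoins n a b r ℓ ρ).1.2.1).length + 2)
      ≤ ∑ _j : Fin (2 ^ ℓ), (2 * 2 ^ ℓ + 2) := Finset.sum_le_sum fun j _ => by linarith [hE j]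
    _ = 2 ^ ℓ * (2 * 2 ^ ℓ + 2) := by rw [Finset.sum_const, Finset.card_univ, Fintype.card_fin, smul_eq_mul]

omit R in
/-- The steps code is at most `t(4k + 2kn + 6)` long. [folklore] -/
theorem length_stepsCode_le {k t : ℕ} (steps : Fin t → Fin k × (Fin k → (Fin n → Bool))) :
    (stepsCode steps).length ≤ t * (4 * k + 2 * (k * n) + 6) := by
  rw [stepsCode, length_body, List.map_ofFn, List.sum_ofFn]
  calc ∑ r : Fin t, (2 * (boolPair (ones (steps r).1) (tupleBits (steps r).2)).length + 2)
      ≤ ∑ _r : Fin t, (4 * k + 2 * (k * n) + 6) := Finset.sum_le_sum fun r _ => by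
        rw [length_boolPair, length_ones, tupleBits, List.length_ofFn]; have := (steps r).1.isLt; omega
    _ = t * (4 * k + 2 * (k * n) + 6) := by rw [Finset.sum_const, Finset.card_univ, Fintype.card_fin, smul_eq_mul]

omit R in
/-- **The candidate string is linear in the coins**: `|candStr| ≤ 384 |r|` on a processed level.
[folklore] -/
theorem length_candStr_le {ℓ : ℕ} (h : LvlProcessed n a b r.length ℓ) (ρ : ℕ) :
    (candStr n a b r f ℓ ρ).length ≤ 384 * r.length := by
  -- abbreviations and basic facts
  have hK := lvlK_pos n a b ℓ
  set K := lvlK n a b ℓ with hKdef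
  set Q := lvlQ n a b ℓ
  set RL := lvlRunLen n a b ℓ with hRLdef
  set RP := prmReps (prmS n a b) ℓ with hRPdef
  set T := prmT (prmS n a b) ℓ
  set KK := prmKK (prmS n a b) ℓ
  have hRL : RL = ℓ + Q * Q + 2 ^ ℓ + KK * K + KK + K + K * n + T * (prmKappa (prmS n a b) ℓ + K * n) := by
    rw [hRLdef, lvlRunLen, runLen, offSt, offA, offPb, offSg, offSd, offW, stepLen]
  have hRP1 : 1 ≤ RP := Nat.one_le_two_pow
  have hT1 : 1 ≤ T := Nat.one_le_two_pow
  have hQ1 : 1 ≤ Q := (prmQ_spec _).2.one_lt.le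
  have hQQ : Q ≤ Q * Q := Nat.le_mul_self Q
  have hκ : 20 ≤ prmKappa (prmS n a b) ℓ := by rw [prmKappa]; omega
  have hblk : RP * RL ≤ r.length := by
    rw [LvlProcessed, lvlCoff, Finset.sum_range_succ, lvlBlockLen] at h
    exact le_trans (Nat.le_add_right _ _) ((Nat.le_add_left _ _).trans h)
  -- `Reps` dominates the exponential quantities
  have hRPK : K * K ≤ RP := by
    rw [hRPdef, prmReps, hKdef, lvlK, prmK, ← pow_add]; exact Nat.pow_le_pow_right (by norm_num) (by omega)
  have hRPL : 2 ^ ℓ * 2 ^ ℓ ≤ RP := by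
    rw [hRPdef, prmReps, ← pow_add]; exact Nat.pow_le_pow_right (by norm_num) (by omega)
  have hRPKK : 2 ^ KK ≤ RP := by
    rw [hRPdef, prmReps]; exact Nat.pow_le_pow_right (by norm_num) (by rw [show KK = prmKK (prmS n a b) ℓ from rfl, prmKK]; omega)
  have hRP64 : 64 ≤ RP := by
    rw [hRPdef, prmReps]; exact le_trans (by norm_num) (Nat.pow_le_pow_right (by norm_num) (by omega : 6 ≤ _))
  -- the length, unfolded
  have hlen : (candStr n a b r f ℓ ρ).length ≤
      8 * (2 * Q + 2 * ℓ + 2 * (K * n + K) + 2 ^ ℓ + 8) + 8 * ℓ + 8 * 2 ^ ℓ + 8 * (2 ^ ℓ * (2 * 2 ^ ℓ + 2)) + 4 * (Q * Q) +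
      4 * (2 * n + 2 * K + 2 * KK + 2 ^ KK + 8) + 4 * (KK * K) + 2 * KK +
      2 * (2 * n + 2 * K + T + 6) + 2 * K + 2 * (K * n) + 2 * K + T * (4 * K + 2 * (K * n) + 6) + 60 := by
    have htb := length_tables_le (n := n) (a := a) (b := b) (r := r) (f := f) (ℓ := ℓ) (ρ := ρ)
    have hsc := length_stepsCode_le (n := n) (lvlCoins n a b r ℓ ρ).2.2.2.2
    rw [candStr, hypRec, dpRec, glRec, predRec, predHdr]
    simp only [length_boolPair, length_ones, List.length_nil, List.length_ofFn, seedBits, tupleBits]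
    linarith [htb, hsc]
  -- every term is `O(RP · RL)`
  have hTk : T * (prmKappa (prmS n a b) ℓ + K * n) = T * prmKappa (prmS n a b) ℓ + T * (K * n) := Nat.mul_add _ _ _
  have hT20 : 20 * T ≤ T * prmKappa (prmS n a b) ℓ := by rw [mul_comm]; exact Nat.mul_le_mul_left _ hκ
  rw [hTk] at hRL
  have e1 : Q * Q ≤ RL := by rw [hRL]; omega
  have e2 : 2 ^ ℓ ≤ RL := by rw [hRL]; generalize 2 ^ ℓ = L at *; omega
  have e3 : KK * K ≤ RL := by rw [hRL]; omega
  have e4 : K * n ≤ RL := by rw [hRL]; omega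
  have e5 : K ≤ RL := by rw [hRL]; omega
  have e6 : ℓ ≤ RL := by rw [hRL]; omega
  have e7 : KK ≤ RL := by rw [hRL]; omega
  have e8 : 20 * T ≤ RL := by rw [hRL]; omega
  have e9 : T * (K * n) ≤ RL := by rw [hRL]; omega
  have e10 : n ≤ RL := le_trans (Nat.le_mul_of_pos_left n hK) e4
  have e11 : T * K ≤ RP * RL := by
    rw [mul_comm RP]; exact Nat.mul_le_mul (by omega) ((Nat.le_mul_self K).trans hRPK)
  have hRL1 : 1 ≤ RL := le_trans hQ1 (hQQ.trans e1)
  have big : RL ≤ RP * RL := Nat.le_mul_of_pos_left _ hRP1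
  have big2 : RP ≤ RP * RL := Nat.le_mul_of_pos_right _ hRL1
  have hmul : 2 ^ ℓ * (2 * 2 ^ ℓ + 2) = 2 * (2 ^ ℓ * 2 ^ ℓ) + 2 * 2 ^ ℓ := by ring
  have hmul2 : T * (4 * K + 2 * (K * n) + 6) = 4 * (T * K) + 2 * (T * (K * n)) + 6 * T := by ring
  rw [hmul, hmul2] at hlen
  linarith

/-! #### Validation and selection -/

/-- **The hypothesis computed by run `ρ` of level `ℓ`** (as a function). [cite: CarmosinoImpagliazzoKabanetsKolokolova2016, §5] -/
noncomputable def hypOf (n a b : ℕ) (r : List Bool) (f : (Fin n → Bool) → Bool) (ℓ ρ : ℕ) : (Fin n → Bool) → Bool :=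
  runHyp (learnerDesign (lvlQ n a b ℓ) n (lvlK n a b ℓ) ℓ (lvl_hn n a b ℓ)) (natTest R ℓ) f (lvlCoins n a b r ℓ ρ)

/-- **The empirical error count** of run `ρ` of level `ℓ` on the level's validation sample. [folklore] -/
noncomputable def errsOf (n a b : ℕ) (r : List Bool) (f : (Fin n → Bool) → Bool) (ℓ ρ : ℕ) : ℕ :=
  ((Finset.range (prmM (prmS n a b) ℓ)).filter fun w =>
    hypOf R n a b r f ℓ ρ (lvlValPt n a b r ℓ w) ≠ f (lvlValPt n a b r ℓ w)).card

/-- The validation test `4a·errs ≤ 3m`. [folklore] -/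
def Passes (n a b : ℕ) (r : List Bool) (f : (Fin n → Bool) → Bool) (ℓ ρ : ℕ) : Prop :=
  4 * a * errsOf R n a b r f ℓ ρ ≤ 3 * prmM (prmS n a b) ℓ

/-- Passing is decidable. [folklore] -/
noncomputable instance (ℓ ρ : ℕ) : Decidable (Passes R n a b r f ℓ ρ) := by unfold Passes; infer_instance

/-- **The selection of level `ℓ`**: the first passing candidate (`ε` if none, or if the level is not
processed). [cite: CarmosinoImpagliazzoKabanetsKolokolova2016, §5] -/
noncomputable def levelSelOut (n a b : ℕ) (r : List Bool) (f : (Fin n → Bool) → Bool) (ℓ : ℕ) : List Bool :=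
  if LvlProcessed n a b r.length ℓ then
    ((List.range (prmReps (prmS n a b) ℓ)).find? fun ρ => decide (Passes R n a b r f ℓ ρ)).elim [] (candStr n a b r f ℓ)
  else []

/-- **The learner's output**: the selection of the first level with a passing candidate. [cite: CarmosinoImpagliazzoKabanetsKolokolova2016, §5] -/
noncomputable def gfnOut (n a b : ℕ) (r : List Bool) (f : (Fin n → Bool) → Bool) : List Bool :=
  ((List.range (r.length + 1)).find? fun ℓ => decide (levelSelOut R n a b r f ℓ ≠ [])).elim [] (levelSelOut R n a b r f)

variable (hdR : ∀ y, dR y = encodeBool ((truthTableLanguage R).boolIndicator y))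
include hdR

/-- **The evaluator on a candidate string computes `hypOf`.** [cite: CarmosinoImpagliazzoKabanetsKolokolova2016, Thm. 5.1] -/
theorem evalFn_candStr (ℓ ρ : ℕ) (x : Fin n → Bool) :
    evalFn dR (boolPair (candStr n a b r f ℓ ρ) (List.ofFn x)) = [hypOf R n a b r f ℓ ρ x] :=
  evalFn_apply (lvl_hn n a b ℓ) R hdR [] f (lvlCoins n a b r ℓ ρ) _
    (fun j hj => learnerTables_getD (lvl_hn n a b ℓ) f _ _ j hj) x

/-- Value of `errPiece` on `⟨⟨w, cand⟩, 1^{wv}⟩` (`wv < m`, processed level `ℓ ≤ |r|`, true answers). [folklore] -/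
theorem errPiece_apply (hR : 1 ≤ r.length) (hT : TrueAnswers n a b r f ans) {ℓ : ℕ} (h : LvlProcessed n a b r.length ℓ)
    (hℓ : ℓ ≤ r.length) (ρ : ℕ) {wv : ℕ} (hwv : wv < prmM (prmS n a b) ℓ) :
    errPiece dR (boolPair (boolPair (wArg n a b r ans ℓ ρ) (candStr n a b r f ℓ ρ)) (ones wv)) =
      [xor (hypOf R n a b r f ℓ ρ (lvlValPt n a b r ℓ wv)) (f (lvlValPt n a b r ℓ wv))] := by
  obtain ⟨hk, hL, hT', hReps, hq, hrl, hcoff, hper, hKK⟩ := bricks_of_processed h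
  obtain ⟨v1, v2, v3, v4, v5, v6⟩ := vArg_fields (n := n) (a := a) (b := b) (r := r) (ans := ans) ℓ
  have hvp : List.take n (List.drop (lvlCoff n a b ℓ + (prmReps (prmS n a b) ℓ * lvlRunLen n a b ℓ + wv * n)) r) =
      List.ofFn (lvlValPt n a b r ℓ wv) := by
    rw [lvlValPt, ← drop_take_eq_ofFn_readBits _ (by have := valPt_fits h hwv; omega), Nat.add_assoc]
  rw [errPiece, HashBricks.xorFn_apply (b := hypOf R n a b r f ℓ ρ (lvlValPt n a b r ℓ wv)) (b' := f (lvlValPt n a b r ℓ wv))]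
  · simp only [Function.comp_apply, fanoutFn_apply, fstF_boolPair, sndF_boolPair, wArg, v1, v3, v4, hcoff, hReps, hrl,
      HashBricks.umulFn_boolPair, appF_boolPair, ones_append_ones, takeFn_boolPair, dropFn_boolPair, length_ones, hvp,
      evalFn_candStr R hdR, HashBricks.headBitFn_apply, List.headD_cons]
  · simp only [Function.comp_apply, fanoutFn_apply, fstF_boolPair, sndF_boolPair, wArg, v1, v2, hReps, hper,
      qoffFn_apply hR hT (hℓ.trans (Nat.le_succ _)), HashBricks.umulFn_boolPair, appF_boolPair, ones_append_ones,
      bitAtFn_boolPair, length_ones, HashBricks.headBitFn_apply, headD_take_one_drop, ans_getD_label hT h hℓ hwv]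

omit hdR in
/-- `m ≤ 2^20 (|EC|+1)^3` for the error-count context (a polynomial round bound). [folklore] -/
theorem prmM_le_cube (ℓ ρ : ℕ) (cand : List Bool) (hℓ : ℓ ≤ r.length) :
    prmM (prmS n a b) ℓ ≤ (2 ^ 20 * (X + 1) ^ 3 : Polynomial ℕ).eval (boolPair (wArg n a b r ans ℓ ρ) cand).length := by
  have hs : prmS n a b ≤ n + a + b + 2 := by
    rw [prmS]; exact (Nat.size_le.2 (Nat.lt_two_pow_self)).trans le_rfl
  have h4 : 4 ^ prmS n a b ≤ 4 * (n + a + b + 2) ^ 2 := by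
    have := two_pow_prmS_le n a b
    calc 4 ^ prmS n a b = (2 ^ prmS n a b) ^ 2 := by rw [← pow_mul, mul_comm, pow_mul]; norm_num
      _ ≤ (2 * (n + a + b + 2)) ^ 2 := Nat.pow_le_pow_left (by omega) 2
      _ = 4 * (n + a + b + 2) ^ 2 := by ring
  have hlen : n + a + b + ℓ ≤ (boolPair (wArg n a b r ans ℓ ρ) cand).length := by
    simp only [wArg, vArg, gArg, pacParams, length_boolPair, length_ones, unaryEncodeNat_eq_ones]; omega
  simp only [eval_mul, eval_pow, eval_add, eval_X, eval_one, eval_ofNat]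
  set E := (boolPair (wArg n a b r ans ℓ ρ) cand).length
  have hN : n + a + b + 2 ≤ E + 2 := by omega
  have hsz : Nat.size ℓ ≤ ℓ + 1 := (Nat.size_le.2 Nat.lt_two_pow_self).trans (Nat.le_succ ℓ)
  calc prmM (prmS n a b) ℓ = 64 * 4 ^ prmS n a b * (8 * prmS n a b + 2 * Nat.size ℓ + 8 * ℓ + 108) := by
        rw [prmM, prmKappa]; ring
    _ ≤ 64 * (4 * (E + 2) ^ 2) * (110 * (E + 3)) := by
        apply Nat.mul_le_mul (Nat.mul_le_mul_left _ (h4.trans (Nat.mul_le_mul_left _ (Nat.pow_le_pow_left hN 2))))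
        omega
    _ ≤ 64 * (4 * (2 * (E + 1)) ^ 2) * (110 * (3 * (E + 1))) := by
        apply Nat.mul_le_mul (Nat.mul_le_mul_left _ (Nat.mul_le_mul_left _ (Nat.pow_le_pow_left (by omega) 2))); omega
    _ = 337920 * (E + 1) ^ 3 := by ring
    _ ≤ 2 ^ 20 * (E + 1) ^ 3 := Nat.mul_le_mul_right _ (by norm_num)

omit hdR in
/-- The sum of indicator bits is the cardinality. [folklore] -/
theorem sum_range_toNat_eq_card (M : ℕ) (p : ℕ → Prop) [DecidablePred p] :
    ∑ w ∈ Finset.range M, (decide (p w)).toNat = ((Finset.range M).filter p).card := by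
  rw [Finset.card_filter]
  exact Finset.sum_congr rfl fun w _ => by by_cases h : p w <;> simp [h]

/-- **Value of `errsFn`**: the binary numeral of `errsOf`. [folklore] -/
theorem errsFn_apply (hR : 1 ≤ r.length) (hT : TrueAnswers n a b r f ans) {ℓ : ℕ} (h : LvlProcessed n a b r.length ℓ)
    (hℓ : ℓ ≤ r.length) (ρ : ℕ) :
    errsFn dR (boolPair (wArg n a b r ans ℓ ρ) (candStr n a b r f ℓ ρ)) = encodeNat (errsOf R n a b r f ℓ ρ) := by
  obtain ⟨v1, v2, v3, v4, v5, v6⟩ := vArg_fields (n := n) (a := a) (b := b) (r := r) (ans := ans) ℓ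
  have hM := prmM_le_cube (n := n) (a := a) (b := b) (r := r) (ans := ans) ℓ ρ (candStr n a b r f ℓ ρ) hℓ
  have hm : lenBinF (((mFn ∘ lvlArgFn) ∘ fstF ∘ fstF) (boolPair (wArg n a b r ans ℓ ρ) (candStr n a b r f ℓ ρ))) =
      encodeNat (prmM (prmS n a b) ℓ) := by
    simp only [Function.comp_apply, fstF_boolPair, wArg, v1, mFn_apply, lenBinF_apply, length_ones]
  rw [errsFn, Function.comp_apply, Function.comp_apply, fanoutFn_apply, fanoutFn_apply, id, Function.comp_apply, hm,
    show (boolPair ([] : List Bool) []) = boolPair (ones 0) (encodeNat 0) by rfl, foldLoop_apply _ _ hM,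
    foldAcc_clipF (fun wv _ hwv => by
      rw [zero_add] at hwv
      rw [errPiece_apply R hdR hR hT h hℓ ρ hwv]; simp), foldAcc_addFn]
  simp only [sndPow, Function.comp_apply, sndF_boolPair, zero_add]
  refine congrArg encodeNat ?_
  rw [errsOf, ← sum_range_toNat_eq_card]
  refine Finset.sum_congr rfl fun wv hwv => ?_
  rw [Finset.mem_range] at hwv
  rw [errPiece_apply R hdR hR hT h hℓ ρ hwv]
  cases hypOf R n a b r f ℓ ρ (lvlValPt n a b r ℓ wv) <;> cases f (lvlValPt n a b r ℓ wv) <;> rfl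

omit hdR in
/-- `errsOf ≤ m`. [folklore] -/
theorem errsOf_le (ℓ ρ : ℕ) : errsOf R n a b r f ℓ ρ ≤ prmM (prmS n a b) ℓ :=
  (Finset.card_filter_le _ _).trans (Finset.card_range _).le

/-- **Value of `passFn`**: the validation test. [folklore] -/
theorem passFn_apply (hR : 1 ≤ r.length) (hT : TrueAnswers n a b r f ans) {ℓ : ℕ} (h : LvlProcessed n a b r.length ℓ)
    (hℓ : ℓ ≤ r.length) (ρ : ℕ) :
    passFn dR (boolPair (wArg n a b r ans ℓ ρ) (candStr n a b r f ℓ ρ)) = [decide (Passes R n a b r f ℓ ρ)] := by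
  obtain ⟨v1, v2, v3, v4, v5, v6⟩ := vArg_fields (n := n) (a := a) (b := b) (r := r) (ans := ans) ℓ
  have hw : fstF (wArg n a b r ans ℓ ρ) = vArg n a b r ans ℓ := by simp [wArg]
  rw [passFn, notFn_apply (b := decide (3 * prmM (prmS n a b) ℓ < 4 * a * errsOf R n a b r f ℓ ρ))]
  · by_cases hp : Passes R n a b r f ℓ ρ
    · rw [decide_eq_true hp, decide_eq_false (not_lt.2 hp)]; rfl
    · rw [decide_eq_false hp, decide_eq_true (not_le.1 hp)]; rfl
  · simp only [Function.comp_apply, fanoutFn_apply, fstF_boolPair, hw, v1, v5, mFn_apply,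
      errsFn_apply R hdR hR hT h hℓ ρ, binToUnaryFn_boolPair, bitsToNat_encodeNat, length_ones,
      min_eq_left (errsOf_le R (n := n) (a := a) (b := b) (r := r) (f := f) ℓ ρ), HashBricks.umulFn_boolPair, ltLenF_boolPair,
      Nat.mul_assoc]

/-- **Value of `selPiece`**: the candidate if it passes. [folklore] -/
theorem selPiece_apply (hR : 1 ≤ r.length) (hT : TrueAnswers n a b r f ans) {ℓ : ℕ} (h : LvlProcessed n a b r.length ℓ)
    (hℓ : ℓ ≤ r.length) {ρ : ℕ} (hρ : ρ < prmReps (prmS n a b) ℓ) :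
    selPiece dR (wArg n a b r ans ℓ ρ) = if Passes R n a b r f ℓ ρ then candStr n a b r f ℓ ρ else [] := by
  rw [selPiece, iteFn_apply (b := decide (Passes R n a b r f ℓ ρ)) (by
    rw [Function.comp_apply, fanoutFn_apply, id, candFn_apply hR hT h hℓ hρ, passFn_apply R hdR hR hT h hℓ ρ])]
  by_cases hp : Passes R n a b r f ℓ ρ
  · rw [decide_eq_true hp, if_pos hp]; exact candFn_apply hR hT h hℓ hρ
  · rw [decide_eq_false hp, if_neg hp]; rfl

omit hdR in
/-- **The "first nonempty" fold.** [folklore] -/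
theorem foldAcc_firstOp (piece : List Bool → List Bool) (x : List Bool) :
    ∀ j : ℕ, foldAcc firstOp piece x 0 j [] =
      ((List.range j).find? fun i => decide (piece (boolPair x (ones i)) ≠ [])).elim [] fun i => piece (boolPair x (ones i))
  | 0 => rfl
  | j + 1 => by
    rw [foldAcc_succ', foldAcc_firstOp piece x j, zero_add, firstOp_boolPair, List.range_succ, List.find?_append]
    rcases hq : (List.range j).find? (fun i => decide (piece (boolPair x (ones i)) ≠ [])) with _ | i
    · simp only [Option.none_or, List.find?_singleton, Option.elim_none]
      by_cases hj : piece (boolPair x (ones j)) = []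
      · rw [decide_eq_false (by simpa using hj)]; simp [hj]
      · rw [decide_eq_true hj]; simp
    · have := List.find?_some hq
      simp only [decide_eq_true_eq] at this
      simp [this]

omit R hdR in
/-- Accessors: the level argument of `vArg` and the processedness brick. [folklore] -/
theorem levelSel_rounds (hR : 1 ≤ r.length) {ℓ : ℕ} (hℓ : ℓ ≤ r.length) :
    (lenBinF ((iteFn (processedFn ∘ lvlArgFn) (repsFn ∘ lvlArgFn) fun _ => []) (vArg n a b r ans ℓ))) =
      encodeNat (if LvlProcessed n a b r.length ℓ then prmReps (prmS n a b) ℓ else 0) := by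
  obtain ⟨v1, v2, v3, v4, v5, v6⟩ := vArg_fields (n := n) (a := a) (b := b) (r := r) (ans := ans) ℓ
  rw [iteFn_apply (b := decide (LvlProcessed n a b r.length ℓ)) (by rw [Function.comp_apply, v1, processedFn_apply n a b r hR hℓ])]
  by_cases hp : LvlProcessed n a b r.length ℓ
  · rw [decide_eq_true hp, if_pos hp]
    simp only [ite_true, Function.comp_apply, v1, (bricks_of_processed hp).2.2.2.1, lenBinF_apply, length_ones]
  · rw [decide_eq_false hp, if_neg hp]; simp

omit hdR in
/-- `find?` depends only on the predicate's values on the list. [folklore] -/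
theorem find?_congr' {α : Type*} (p q : α → Bool) : ∀ l : List α, (∀ x ∈ l, p x = q x) → l.find? p = l.find? q
  | [], _ => rfl
  | x :: l, h => by
    rw [List.find?_cons, List.find?_cons, h x (by simp), find?_congr' p q l fun y hy => h y (by simp [hy])]

omit hdR in
/-- A candidate string is never empty. [folklore] -/
theorem candStr_ne_nil (ℓ ρ : ℕ) : candStr n a b r f ℓ ρ ≠ [] := by
  intro h0
  have := congrArg List.length h0
  rw [candStr, hypRec, dpRec, length_boolPair, List.length_nil] at this
  omega

/-- **Value of `levelSelFn`**: the selection of the level. [cite: CarmosinoImpagliazzoKabanetsKolokolova2016, §5] -/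
theorem levelSelFn_apply (hR : 1 ≤ r.length) (hT : TrueAnswers n a b r f ans) {ℓ : ℕ} (hℓ : ℓ ≤ r.length) :
    levelSelFn dR (vArg n a b r ans ℓ) = levelSelOut R n a b r f ℓ := by
  have hrounds : (if LvlProcessed n a b r.length ℓ then prmReps (prmS n a b) ℓ else 0) ≤ X.eval (vArg n a b r ans ℓ).length := by
    rw [eval_X]
    split_ifs with hp
    · refine (capsExact_of_processed hp).2.2.2.trans ?_
      simp only [vArg, gArg, length_boolPair]; omega
    · exact Nat.zero_le _
  rw [levelSelFn, Function.comp_apply, Function.comp_apply, fanoutFn_apply, fanoutFn_apply, id, Function.comp_apply,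
    levelSel_rounds hR hℓ, show (boolPair ([] : List Bool) []) = boolPair (ones 0) ([] : List Bool) by rfl,
    foldLoop_apply _ _ hrounds, levelSelOut]
  by_cases hp : LvlProcessed n a b r.length ℓ
  · rw [if_pos hp, if_pos hp, foldAcc_clipF (fun ρ _ hρ => by
      rw [zero_add] at hρ
      rw [show boolPair (vArg n a b r ans ℓ) (ones ρ) = wArg n a b r ans ℓ ρ from rfl, selPiece_apply R hdR hR hT hp hℓ hρ]
      split_ifs
      · refine (length_candStr_le hp ρ).trans ?_
        simp only [vArg, gArg, length_boolPair]; omega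
      · exact Nat.zero_le _), foldAcc_firstOp]
    simp only [sndPow, Function.comp_apply, sndF_boolPair]
    -- identify the pieces with `selPiece_apply` inside the search over `ρ < Reps`
    have hfind : (List.range (prmReps (prmS n a b) ℓ)).find? (fun i => decide (selPiece dR (boolPair (vArg n a b r ans ℓ) (ones i)) ≠ [])) =
        (List.range (prmReps (prmS n a b) ℓ)).find? fun ρ => decide (Passes R n a b r f ℓ ρ) := by
      refine find?_congr' _ _ _ fun ρ hρ => ?_
      rw [List.mem_range] at hρ
      rw [show boolPair (vArg n a b r ans ℓ) (ones ρ) = wArg n a b r ans ℓ ρ from rfl, selPiece_apply R hdR hR hT hp hℓ hρ]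
      by_cases hpass : Passes R n a b r f ℓ ρ
      · simp only [ite_true, ne_eq, candStr_ne_nil ℓ ρ, not_false_eq_true, decide_true, hpass]
      · simp only [ite_false, ne_eq, not_true_eq_false, decide_false, hpass]
    rw [hfind]
    have key : ∀ o : Option ℕ, (∀ i, o = some i → i < prmReps (prmS n a b) ℓ ∧ Passes R n a b r f ℓ i) →
        o.elim [] (fun i => selPiece dR (boolPair (vArg n a b r ans ℓ) (ones i))) = o.elim [] (candStr n a b r f ℓ) := by
      rintro (_ | i) hi
      · rfl
      · obtain ⟨h2, h1⟩ := hi i rfl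
        simp only [Option.elim_some]
        rw [show boolPair (vArg n a b r ans ℓ) (ones i) = wArg n a b r ans ℓ i from rfl, selPiece_apply R hdR hR hT hp hℓ h2, if_pos h1]
    have hsome : ∀ i, (List.range (prmReps (prmS n a b) ℓ)).find? (fun ρ => decide (Passes R n a b r f ℓ ρ)) = some i →
        i < prmReps (prmS n a b) ℓ ∧ Passes R n a b r f ℓ i := fun i hi =>
      ⟨List.mem_range.1 (List.mem_of_find?_eq_some hi), by simpa using List.find?_some hi⟩
    exact key _ hsome
  · rw [if_neg hp, if_neg hp]
    simp only [sndPow, Function.comp_apply, sndF_boolPair]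
    rfl

omit hdR in
/-- `levelSelOut` is short: `≤ 384 |r|`. [folklore] -/
theorem length_levelSelOut_le (ℓ : ℕ) : (levelSelOut R n a b r f ℓ).length ≤ 384 * r.length := by
  rw [levelSelOut]
  split_ifs with hp
  · rcases (List.range (prmReps (prmS n a b) ℓ)).find? (fun ρ => decide (Passes R n a b r f ℓ ρ)) with _ | ρ
    · exact Nat.zero_le _
    · exact length_candStr_le hp ρ
  · exact Nat.zero_le _

/-- **Value of the learner's output function**: `lrnGFn dR ⟨x, answers⟩ = gfnOut` (true answers, `|r| ≥ 1`).
[cite: CarmosinoImpagliazzoKabanetsKolokolova2016, §5 (complete algorithm)] -/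
theorem lrnGFn_apply (hR : 1 ≤ r.length) (hT : TrueAnswers n a b r f ans) :
    lrnGFn dR (gArg n a b r ans) = gfnOut R n a b r f := by
  have hr : sndF (fstF (gArg n a b r ans)) = r := by simp [gArg]
  have hrounds : r.length + 1 ≤ X.eval (gArg n a b r ans).length := by
    rw [eval_X, gArg, length_boolPair, length_boolPair]; omega
  rw [lrnGFn, Function.comp_apply, Function.comp_apply, fanoutFn_apply, fanoutFn_apply, id]
  simp only [Function.comp_apply, fanoutFn_apply, hr, onesFn_eq_ones, appF_boolPair, show [true] = ones 1 from rfl,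
    ones_append_ones, lenBinF_apply, length_ones]
  rw [show (boolPair ([] : List Bool) []) = boolPair (ones 0) ([] : List Bool) by rfl, foldLoop_apply _ _ hrounds,
    foldAcc_clipF (fun ℓ _ hℓ => by
      rw [zero_add] at hℓ
      rw [show boolPair (gArg n a b r ans) (ones ℓ) = vArg n a b r ans ℓ from rfl, levelSelFn_apply R hdR hR hT (by omega)]
      refine (length_levelSelOut_le R (n := n) (a := a) (b := b) (r := r) (f := f) ℓ).trans ?_
      rw [gArg, length_boolPair, length_boolPair]; omega),
    foldAcc_firstOp]
  simp only [sndPow, Function.comp_apply, sndF_boolPair]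
  have hfind : (List.range (r.length + 1)).find? (fun ℓ => decide (levelSelFn dR (boolPair (gArg n a b r ans) (ones ℓ)) ≠ [])) =
      (List.range (r.length + 1)).find? fun ℓ => decide (levelSelOut R n a b r f ℓ ≠ []) := by
    refine find?_congr' _ _ _ fun ℓ hℓ => ?_
    rw [List.mem_range] at hℓ
    rw [show boolPair (gArg n a b r ans) (ones ℓ) = vArg n a b r ans ℓ from rfl, levelSelFn_apply R hdR hR hT (by omega)]
  rw [hfind, gfnOut]
  have key : ∀ o : Option ℕ, (∀ ℓ, o = some ℓ → ℓ < r.length + 1) →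
      o.elim [] (fun ℓ => levelSelFn dR (boolPair (gArg n a b r ans) (ones ℓ))) = o.elim [] (levelSelOut R n a b r f) := by
    rintro (_ | ℓ) hℓ
    · rfl
    · simp only [Option.elim_some]
      rw [show boolPair (gArg n a b r ans) (ones ℓ) = vArg n a b r ans ℓ from rfl, levelSelFn_apply R hdR hR hT (by have := hℓ ℓ rfl; omega)]
  have hsome : ∀ ℓ, (List.range (r.length + 1)).find? (fun ℓ => decide (levelSelOut R n a b r f ℓ ≠ [])) = some ℓ → ℓ < r.length + 1 :=
    fun ℓ hℓ => List.mem_range.1 (List.mem_of_find?_eq_some hℓ)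
  exact key _ hsome

end Values


end Literature.Computability.Learning
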